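import Summits.ValiantsHypothesis.ValiantsHypothesis.Theorems.KPlusLogSqLawStaticPathOpt

/-!
# Route «KPlusLogSqLaw» — parametric max-weight independent set on a path: GLUING two chains of unique optima (superadditivity)

HONEST FRAMING.  Helper toward the crux `WeakLifting` (item `stmt-ValiantsHypothesis-19561`, route `KPlusLogSqLaw`, cell `pub-symmetroid`,
seat val-sym-lift-p4 g8, 2026-08-27) on the line of its witness-plan stub `stub_tridiagonalSectorB` (tropical twin of the STATIC tridiagonal
sector = parametric maximum-weight independent set on a path).  The kernel floors of the sector are CHAIN CERTIFICATES: weights affine in the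
parameter `θ`, strictly increasing samples `θ_0 < … < θ_N`, at each sample a UNIQUE optimal independent subset of the block, consecutive optima
distinct (`exists_chain_length`: `N = n` on `n` items; `exists_chain_five_on_four`; `exists_chain_twelve_on_eight`; the `n = 15` certificate).
This file proves the structural **GLUING THEOREM** `chain_glue` / `exists_chain_add`: a chain of `N₁` changes on `n₁` items and a chain of `N₂`
changes on `n₂` items give a chain of `N₁ + N₂` changes on `n₁ + 1 + n₂` items — so the maximal chain length is superadditive up to one
separator item, and every located certificate becomes an ALL-`n` floor of its own rate (`26/16` from the `n = 15` certificate, against rate `1`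
from `exists_chain_length`).  Construction: block 1 keeps its weights; one SEPARATOR item of constant weight `-1` (never optimal: dropping it
gains); block 2 is re-parametrised through the MÖBIUS map `θ ↦ ψ₀ + c / (p - θ)` and rescaled by the positive factor `p - θ` — which keeps
the weights affine: item `a` of block 2 gets `(p - θ)(v₁ a ψ₀ + v₀ a) + c v₁ a` — so that all of block 1's samples see block 2 frozen near
its first sample and all of block 2's samples (pulled back) see block 1 frozen near its last sample; "frozen" is the PERSISTENCE lemma
`unique_persists` (a strict unique optimum at `θ₀` stays so on a neighbourhood, finitely many affine competitors).
Nothing here asserts anything about `WeakLifting`, `TropicalB`, `KPlusLogSqLaw`, the stub in its window, `MatrixDescartes`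
(stmt-ValiantsHypothesis-18050) or `VP ≠ VNP`.
-/

set_option linter.dupNamespace false
set_option autoImplicit false

namespace Summit.ValiantsHypothesis.ValiantsHypothesis.Theorems.KPlusLogSqLaw

open Finset Classical

namespace StaticPathFold

noncomputable section

/-! ## 1. Persistence of a unique optimum -/

/-- the weight of a set is affine in the parameter. [folklore] -/
theorem sum_W_affine (w₁ w₀ : ℕ → ℝ) (S : Finset ℕ) (θ θ₀ : ℝ) :
    ∑ t ∈ S, W w₁ w₀ t θ = ∑ t ∈ S, W w₁ w₀ t θ₀ + (θ - θ₀) * ∑ t ∈ S, w₁ t := by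
  simp only [W, Finset.mul_sum, ← Finset.sum_add_distrib]
  exact Finset.sum_congr rfl fun t _ => by ring

/-- a finite family of conditions, each holding for every small enough positive radius, holds simultaneously at some positive
radius. [folklore] -/
theorem exists_pos_forall_mem {α : Type*} (T : Finset α) (P : α → ℝ → Prop)
    (hanti : ∀ a ρ ρ', 0 < ρ' → ρ' ≤ ρ → P a ρ → P a ρ')
    (h : ∀ a ∈ T, ∃ ρ : ℝ, 0 < ρ ∧ P a ρ) : ∃ ρ : ℝ, 0 < ρ ∧ ∀ a ∈ T, P a ρ := by
  classical
  induction T using Finset.induction_on with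
  | empty => exact ⟨1, one_pos, fun a ha => absurd ha (by simp)⟩
  | insert a T _ ih =>
    obtain ⟨ρ₁, hρ₁, h₁⟩ := h a (Finset.mem_insert_self a T)
    obtain ⟨ρ₂, hρ₂, h₂⟩ := ih fun b hb => h b (Finset.mem_insert_of_mem hb)
    refine ⟨min ρ₁ ρ₂, lt_min hρ₁ hρ₂, fun b hb => ?_⟩
    rcases Finset.mem_insert.mp hb with rfl | hb
    · exact hanti _ _ _ (lt_min hρ₁ hρ₂) (min_le_left _ _) h₁
    · exact hanti _ _ _ (lt_min hρ₁ hρ₂) (min_le_right _ _) (h₂ b hb)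

/-- **PERSISTENCE**: a strict unique optimum at `θ₀` stays the strict unique optimum at every parameter within some positive radius
(finitely many affine competitors, each beaten by a positive margin at `θ₀`). [folklore] -/
theorem unique_persists (w₁ w₀ : ℕ → ℝ) {i n : ℕ} {θ₀ : ℝ} {M : Finset ℕ}
    (huniq : ∀ S ∈ indepSets i n, S ≠ M → ∑ t ∈ S, W w₁ w₀ t θ₀ < ∑ t ∈ M, W w₁ w₀ t θ₀) :
    ∃ ρ : ℝ, 0 < ρ ∧ ∀ θ : ℝ, |θ - θ₀| ≤ ρ → ∀ S ∈ indepSets i n, S ≠ M →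
      ∑ t ∈ S, W w₁ w₀ t θ < ∑ t ∈ M, W w₁ w₀ t θ := by
  have hS : ∀ S ∈ indepSets i n, ∃ ρ : ℝ, 0 < ρ ∧ (S ≠ M → ∀ θ : ℝ, |θ - θ₀| ≤ ρ →
      ∑ t ∈ S, W w₁ w₀ t θ < ∑ t ∈ M, W w₁ w₀ t θ) := by
    intro S hS
    by_cases hSM : S = M
    · exact ⟨1, one_pos, fun h => absurd hSM h⟩
    -- the margin `g > 0` at `θ₀` survives while `|θ - θ₀| · |slope difference| < g`
    set g := ∑ t ∈ M, W w₁ w₀ t θ₀ - ∑ t ∈ S, W w₁ w₀ t θ₀ with hg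
    set d := ∑ t ∈ M, w₁ t - ∑ t ∈ S, w₁ t with hd
    have hgpos : 0 < g := sub_pos.mpr (huniq S hS hSM)
    have hden : 0 < |d| + 1 := by positivity
    refine ⟨g / (2 * (|d| + 1)), div_pos hgpos (by positivity), fun _ θ hθ => ?_⟩
    have hθ' : |θ - θ₀| * (|d| + 1) ≤ g / 2 := by
      have hne : |d| + 1 ≠ 0 := hden.ne'
      calc |θ - θ₀| * (|d| + 1) ≤ g / (2 * (|d| + 1)) * (|d| + 1) := mul_le_mul_of_nonneg_right hθ hden.le
        _ = g / 2 := by field_simp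
    have h1 : |(θ - θ₀) * d| ≤ g / 2 := by
      rw [abs_mul]; nlinarith [abs_nonneg (θ - θ₀), abs_nonneg d]
    have h2 := (abs_le.mp h1).1
    have h3 : (θ - θ₀) * d = (θ - θ₀) * ∑ t ∈ M, w₁ t - (θ - θ₀) * ∑ t ∈ S, w₁ t := by rw [hd]; ring
    rw [sum_W_affine w₁ w₀ S θ θ₀, sum_W_affine w₁ w₀ M θ θ₀]
    linarith
  obtain ⟨ρ, hρ, h⟩ := exists_pos_forall_mem (indepSets i n)
    (fun S ρ => S ≠ M → ∀ θ : ℝ, |θ - θ₀| ≤ ρ → ∑ t ∈ S, W w₁ w₀ t θ < ∑ t ∈ M, W w₁ w₀ t θ)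
    (fun S ρ ρ' _ hle hP hSM θ hθ => hP hSM θ (hθ.trans hle)) hS
  exact ⟨ρ, hρ, fun θ hθ S hS' hSM => h S hS' hSM θ hθ⟩

/-! ## 2. Shifted blocks -/

/-- shifting an independent subset of the block `1, …, n` by `s` gives an independent subset of the block `s+1, …, s+n`. [folklore] -/
theorem map_add_mem_indepSets {n : ℕ} (s : ℕ) {B : Finset ℕ} (hB : B ∈ indepSets 0 n) :
    B.map (addLeftEmbedding s) ∈ indepSets s n := by
  rcases mem_indepSets.mp hB with ⟨hB1, hB2⟩
  refine mem_indepSets.mpr ⟨fun t ht => ?_, fun t ht ht1 => ?_⟩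
  · obtain ⟨a, ha, rfl⟩ := Finset.mem_map.mp ht
    have := mem_Ioc.mp (hB1 ha)
    simp only [addLeftEmbedding_apply, mem_Ioc]; omega
  · obtain ⟨a, ha, rfl⟩ := Finset.mem_map.mp ht
    obtain ⟨a', ha', he⟩ := Finset.mem_map.mp ht1
    simp only [addLeftEmbedding_apply] at he
    exact hB2 a ha (by convert ha' using 1; omega)

/-- every independent subset of the block `s+1, …, s+n` is the shift by `s` of one of the block `1, …, n`. [folklore] -/
theorem exists_eq_map_add {n s : ℕ} {B' : Finset ℕ} (hB' : B' ∈ indepSets s n) :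
    ∃ B ∈ indepSets 0 n, B' = B.map (addLeftEmbedding s) := by
  rcases mem_indepSets.mp hB' with ⟨h1, h2⟩
  refine ⟨B'.image (fun t => t - s), mem_indepSets.mpr ⟨fun a ha => ?_, fun a ha ha1 => ?_⟩, ?_⟩
  · obtain ⟨t, ht, rfl⟩ := Finset.mem_image.mp ha
    have := mem_Ioc.mp (h1 ht); rw [mem_Ioc]; omega
  · obtain ⟨t, ht, rfl⟩ := Finset.mem_image.mp ha
    obtain ⟨t', ht', he⟩ := Finset.mem_image.mp ha1
    have := mem_Ioc.mp (h1 ht); have := mem_Ioc.mp (h1 ht')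
    exact h2 t ht (by convert ht' using 1; omega)
  · ext t
    simp only [Finset.mem_map, Finset.mem_image, addLeftEmbedding_apply]
    constructor
    · intro ht
      have := mem_Ioc.mp (h1 ht)
      exact ⟨t - s, ⟨t, ht, rfl⟩, by omega⟩
    · rintro ⟨a, ⟨t', ht', rfl⟩, rfl⟩
      have := mem_Ioc.mp (h1 ht'); convert ht' using 1; omega

/-- two unions of a low part (`≤ m`) and a high part (`> m`) agree only if the parts agree. [folklore] -/
theorem eq_and_eq_of_union_eq {A A' B B' : Finset ℕ} {m : ℕ} (hA : ∀ t ∈ A, t ≤ m) (hA' : ∀ t ∈ A', t ≤ m)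
    (hB : ∀ t ∈ B, m < t) (hB' : ∀ t ∈ B', m < t) (h : A ∪ B = A' ∪ B') : A = A' ∧ B = B' := by
  have hmem : ∀ t, (t ∈ A ∨ t ∈ B ↔ t ∈ A' ∨ t ∈ B') := fun t => by
    simpa only [mem_union] using Finset.ext_iff.mp h t
  refine ⟨Finset.ext fun t => ⟨fun ht => ?_, fun ht => ?_⟩, Finset.ext fun t => ⟨fun ht => ?_, fun ht => ?_⟩⟩
  · rcases (hmem t).mp (Or.inl ht) with h' | h'
    exacts [h', absurd (hA t ht) (not_le.mpr (hB' t h'))]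
  · rcases (hmem t).mpr (Or.inl ht) with h' | h'
    exacts [h', absurd (hA' t ht) (not_le.mpr (hB t h'))]
  · rcases (hmem t).mp (Or.inr ht) with h' | h'
    exacts [absurd (hA' t h') (not_le.mpr (hB t ht)), h']
  · rcases (hmem t).mpr (Or.inr ht) with h' | h'
    exacts [absurd (hA t h') (not_le.mpr (hB' t ht)), h']

/-! ## 3. Two blocks around a repelling separator -/

/-- **block decomposition of uniqueness**: if item `n₁ + 1` has negative weight, `A` is the best independent subset of the block
`1, …, n₁` (strictly against every other one) and `B'` the best of the block `n₁ + 2, …, n₁ + 1 + n₂` (likewise), then `A ∪ B'` is the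
strict unique optimum of the whole block `1, …, n₁ + 1 + n₂`. [folklore] -/
theorem glue_unique (w₁ w₀ : ℕ → ℝ) {n₁ n₂ : ℕ} {θ : ℝ} {A B' : Finset ℕ}
    (hA : A ∈ indepSets 0 n₁) (hB' : B' ∈ indepSets (n₁ + 1) n₂)
    (h1 : ∀ S ∈ indepSets 0 n₁, ∑ t ∈ S, W w₁ w₀ t θ ≤ ∑ t ∈ A, W w₁ w₀ t θ ∧
      (S ≠ A → ∑ t ∈ S, W w₁ w₀ t θ < ∑ t ∈ A, W w₁ w₀ t θ))
    (h2 : ∀ S ∈ indepSets (n₁ + 1) n₂, ∑ t ∈ S, W w₁ w₀ t θ ≤ ∑ t ∈ B', W w₁ w₀ t θ ∧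
      (S ≠ B' → ∑ t ∈ S, W w₁ w₀ t θ < ∑ t ∈ B', W w₁ w₀ t θ))
    (hsep : W w₁ w₀ (n₁ + 1) θ < 0) :
    ∀ S ∈ indepSets 0 (n₁ + 1 + n₂), S ≠ A ∪ B' → ∑ t ∈ S, W w₁ w₀ t θ < ∑ t ∈ A ∪ B', W w₁ w₀ t θ := by
  have hAB : ∑ t ∈ A ∪ B', W w₁ w₀ t θ = ∑ t ∈ A, W w₁ w₀ t θ + ∑ t ∈ B', W w₁ w₀ t θ :=
    sum_union_of_blocks w₁ w₀ hA hB' (by omega) θ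
  -- a separator-free competitor splits into its two block parts
  have key : ∀ T ∈ indepSets 0 (n₁ + 1 + n₂), n₁ + 1 ∉ T →
      ∑ t ∈ T, W w₁ w₀ t θ ≤ ∑ t ∈ A ∪ B', W w₁ w₀ t θ ∧
      (T ≠ A ∪ B' → ∑ t ∈ T, W w₁ w₀ t θ < ∑ t ∈ A ∪ B', W w₁ w₀ t θ) := by
    intro T hT hout
    have hT₁ : T ∩ Ioc 0 (0 + n₁) ∈ indepSets 0 n₁ := inter_mem_indepSets hT
    have hT₂ : T ∩ Ioc (0 + n₁ + 1) (0 + n₁ + 1 + n₂) ∈ indepSets (0 + n₁ + 1) n₂ := inter_mem_indepSets hT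
    have hsplit := eq_union_of_not_mem (l := n₁) (m := n₂) hT (by simpa using hout) (by omega)
    simp only [Nat.zero_add] at hT₁ hT₂ hsplit
    have hsum : ∑ t ∈ T, W w₁ w₀ t θ =
        ∑ t ∈ T ∩ Ioc 0 n₁, W w₁ w₀ t θ + ∑ t ∈ T ∩ Ioc (n₁ + 1) (n₁ + 1 + n₂), W w₁ w₀ t θ := by
      conv_lhs => rw [hsplit]
      exact sum_union_of_blocks w₁ w₀ hT₁ hT₂ (by omega) θ
    obtain ⟨hle₁, hlt₁⟩ := h1 _ hT₁
    obtain ⟨hle₂, hlt₂⟩ := h2 _ hT₂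
    refine ⟨by rw [hsum, hAB]; exact add_le_add hle₁ hle₂, fun hne => ?_⟩
    rw [hsum, hAB]
    by_cases he₁ : T ∩ Ioc 0 n₁ = A
    · have he₂ : T ∩ Ioc (n₁ + 1) (n₁ + 1 + n₂) ≠ B' := fun he₂ => hne (by rw [hsplit, he₁, he₂])
      exact add_lt_add_of_le_of_lt hle₁ (hlt₂ he₂)
    · exact add_lt_add_of_lt_of_le (hlt₁ he₁) hle₂
  intro S hS hne
  by_cases hsepS : n₁ + 1 ∈ S
  · -- with the separator: dropping it gains, and the rest is at most the optimum
    have hS' : S.erase (n₁ + 1) ∈ indepSets 0 (n₁ + 1 + n₂) := by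
      rcases mem_indepSets.mp hS with ⟨hS1, hS2⟩
      exact mem_indepSets.mpr ⟨fun t ht => hS1 (mem_of_mem_erase ht),
        fun t ht ht1 => hS2 t (mem_of_mem_erase ht) (mem_of_mem_erase ht1)⟩
    have h := (key _ hS' (fun h => (Finset.mem_erase.mp h).1 rfl)).1
    rw [← Finset.add_sum_erase S _ hsepS]
    linarith
  · exact (key S hS hsepS).2 hne

/-! ## 4. The gluing theorem -/

/-- **GLUING THEOREM.**  A chain of `N₁` changes of the unique optimum on `n₁` items and a chain of `N₂` changes on `n₂` items give a chain
of `N₁ + N₂` changes on `n₁ + 1 + n₂` items (block 1 as is; a separator of weight `-1`; block 2 re-parametrised by the Möbius map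
`θ ↦ ψ 0 + c / (p - θ)` and rescaled by `p - θ > 0`, with `p` just right of block 1's last sample and `c > 0` small). [folklore] -/
theorem chain_glue {n₁ N₁ n₂ N₂ : ℕ}
    (u₁ u₀ : ℕ → ℝ) (φ : Fin (N₁ + 1) → ℝ) (A : Fin (N₁ + 1) → Finset ℕ) (hφ : StrictMono φ)
    (hA : ∀ k, A k ∈ indepSets 0 n₁)
    (huA : ∀ k, ∀ S ∈ indepSets 0 n₁, S ≠ A k → ∑ t ∈ S, W u₁ u₀ t (φ k) < ∑ t ∈ A k, W u₁ u₀ t (φ k))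
    (hAs : ∀ e : Fin N₁, A e.castSucc ≠ A e.succ)
    (v₁ v₀ : ℕ → ℝ) (ψ : Fin (N₂ + 1) → ℝ) (B : Fin (N₂ + 1) → Finset ℕ) (hψ : StrictMono ψ)
    (hB : ∀ k, B k ∈ indepSets 0 n₂)
    (huB : ∀ k, ∀ S ∈ indepSets 0 n₂, S ≠ B k → ∑ t ∈ S, W v₁ v₀ t (ψ k) < ∑ t ∈ B k, W v₁ v₀ t (ψ k))
    (hBs : ∀ e : Fin N₂, B e.castSucc ≠ B e.succ) :
    ∃ (w₁ w₀ : ℕ → ℝ) (θs : Fin (N₁ + N₂ + 1) → ℝ) (Ms : Fin (N₁ + N₂ + 1) → Finset ℕ),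
      StrictMono θs ∧ (∀ k, Ms k ∈ indepSets 0 (n₁ + 1 + n₂)) ∧
      (∀ k, ∀ S ∈ indepSets 0 (n₁ + 1 + n₂), S ≠ Ms k →
        ∑ t ∈ S, W w₁ w₀ t (θs k) < ∑ t ∈ Ms k, W w₁ w₀ t (θs k)) ∧
      (∀ e : Fin (N₁ + N₂), Ms e.castSucc ≠ Ms e.succ) := by
  -- persistence radii at the last sample of chain 1 and at the first sample of chain 2
  obtain ⟨ρ, hρ, hρA⟩ := unique_persists u₁ u₀ (huA (Fin.last N₁))
  obtain ⟨ρ₂, hρ₂, hρB⟩ := unique_persists v₁ v₀ (huB 0)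
  -- the first gap of chain 2 (or `1` if it has a single sample)
  set m : ℝ := if h : 0 < N₂ then ψ ⟨1, by omega⟩ - ψ 0 else 1 with hm
  have hmpos : 0 < m := by
    rw [hm]; split_ifs with h
    · have h01 : (0 : Fin (N₂ + 1)) < ⟨1, by omega⟩ := by rw [Fin.lt_def]; simp
      exact sub_pos.mpr (hψ h01)
    · exact one_pos
  have hmle : ∀ j : Fin (N₂ + 1), 1 ≤ (j : ℕ) → m ≤ ψ j - ψ 0 := by
    intro j hj
    have hN : 0 < N₂ := by have := j.isLt; omega
    rw [hm, dif_pos hN]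
    have : ψ ⟨1, by omega⟩ ≤ ψ j := hψ.monotone (by rw [Fin.le_def]; exact hj)
    linarith
  -- the pole `p` and the scale `c`
  set p : ℝ := φ (Fin.last N₁) + ρ with hp
  set c : ℝ := ρ * min ρ₂ m / 2 with hc
  have hminpos : 0 < min ρ₂ m := lt_min hρ₂ hmpos
  have hcpos : 0 < c := by rw [hc]; positivity
  have hcρ₂ : c ≤ ρ * ρ₂ / 2 := by rw [hc]; have := min_le_left ρ₂ m; nlinarith
  have hcm : c ≤ ρ * m / 2 := by rw [hc]; have := min_le_right ρ₂ m; nlinarith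
  -- index bookkeeping: sample `k` of the glued chain reads sample `min k N₁` of chain 1 and sample `k - N₁` of chain 2
  set κ₁ : Fin (N₁ + N₂ + 1) → Fin (N₁ + 1) := fun k => ⟨min (k : ℕ) N₁, by omega⟩ with hκ₁
  set κ₂ : Fin (N₁ + N₂ + 1) → Fin (N₂ + 1) := fun k => ⟨(k : ℕ) - N₁, by have := k.isLt; omega⟩ with hκ₂
  have hκ₁v : ∀ k, (κ₁ k : ℕ) = min (k : ℕ) N₁ := fun k => by simp only [hκ₁]
  have hκ₂v : ∀ k, (κ₂ k : ℕ) = (k : ℕ) - N₁ := fun k => by simp only [hκ₂]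
  -- the glued instance
  set w₁ : ℕ → ℝ := fun t => if t ≤ n₁ then u₁ t else if t = n₁ + 1 then 0
    else -(v₁ (t - (n₁ + 1)) * ψ 0 + v₀ (t - (n₁ + 1))) with hw₁
  set w₀ : ℕ → ℝ := fun t => if t ≤ n₁ then u₀ t else if t = n₁ + 1 then -1
    else p * (v₁ (t - (n₁ + 1)) * ψ 0 + v₀ (t - (n₁ + 1))) + c * v₁ (t - (n₁ + 1)) with hw₀
  set θs : Fin (N₁ + N₂ + 1) → ℝ := fun k =>
    if (k : ℕ) ≤ N₁ then φ (κ₁ k) else p - c / (ψ (κ₂ k) - ψ 0) with hθs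
  set Ms : Fin (N₁ + N₂ + 1) → Finset ℕ := fun k =>
    A (κ₁ k) ∪ (B (κ₂ k)).map (addLeftEmbedding (n₁ + 1)) with hMs
  -- closed forms of the glued weights
  have hW1 : ∀ t, t ≤ n₁ → ∀ θ, W w₁ w₀ t θ = W u₁ u₀ t θ := by
    intro t ht θ; simp only [W, hw₁, hw₀, if_pos ht]
  have hWsep : ∀ θ, W w₁ w₀ (n₁ + 1) θ = -1 := by
    intro θ; simp [W, hw₁, hw₀]
  have hW2 : ∀ a, 1 ≤ a → ∀ θ, W w₁ w₀ (n₁ + 1 + a) θ = (p - θ) * (v₁ a * ψ 0 + v₀ a) + c * v₁ a := by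
    intro a ha θ
    have h1 : ¬ (n₁ + 1 + a ≤ n₁) := by omega
    have h2 : n₁ + 1 + a ≠ n₁ + 1 := by omega
    have h3 : n₁ + 1 + a - (n₁ + 1) = a := by omega
    simp only [W, hw₁, hw₀, if_neg h1, if_neg h2, h3]; ring
  have hsum1 : ∀ S ∈ indepSets 0 n₁, ∀ θ, ∑ t ∈ S, W w₁ w₀ t θ = ∑ t ∈ S, W u₁ u₀ t θ := by
    intro S hS θ
    refine Finset.sum_congr rfl fun t ht => hW1 t ?_ θ
    have := mem_Ioc.mp ((mem_indepSets.mp hS).1 ht); omega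
  have hsum2 : ∀ S ∈ indepSets 0 n₂, ∀ θ, θ < p →
      ∑ t ∈ S.map (addLeftEmbedding (n₁ + 1)), W w₁ w₀ t θ =
        (p - θ) * ∑ a ∈ S, W v₁ v₀ a (ψ 0 + c / (p - θ)) := by
    intro S hS θ hθ
    rw [Finset.sum_map, Finset.mul_sum]
    refine Finset.sum_congr rfl fun a ha => ?_
    have ha1 : 1 ≤ a := by have := mem_Ioc.mp ((mem_indepSets.mp hS).1 ha); omega
    rw [addLeftEmbedding_apply, hW2 a ha1 θ]
    have hne : p - θ ≠ 0 := by linarith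
    simp only [W]; field_simp; ring
  -- where the samples sit
  have hθle : ∀ k : Fin (N₁ + N₂ + 1), (k : ℕ) ≤ N₁ → θs k = φ (κ₁ k) := fun k hk => by simp only [hθs, if_pos hk]
  have hθgt : ∀ k : Fin (N₁ + N₂ + 1), ¬ (k : ℕ) ≤ N₁ → θs k = p - c / (ψ (κ₂ k) - ψ 0) := fun k hk => by
    simp only [hθs, if_neg hk]
  have hφle : ∀ k, φ (κ₁ k) ≤ φ (Fin.last N₁) := fun k => hφ.monotone (Fin.le_last _)
  have hdk : ∀ k : Fin (N₁ + N₂ + 1), ¬ (k : ℕ) ≤ N₁ →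
      m ≤ ψ (κ₂ k) - ψ 0 ∧ 0 < c / (ψ (κ₂ k) - ψ 0) ∧ c / (ψ (κ₂ k) - ψ 0) ≤ ρ / 2 := by
    intro k hk
    have h1 : m ≤ ψ (κ₂ k) - ψ 0 := hmle _ (by rw [hκ₂v]; omega)
    have h2 : 0 < ψ (κ₂ k) - ψ 0 := lt_of_lt_of_le hmpos h1
    refine ⟨h1, div_pos hcpos h2, ?_⟩
    rw [div_le_iff₀ h2]; nlinarith
  have hθp : ∀ k, θs k < p := by
    intro k
    by_cases hk : (k : ℕ) ≤ N₁
    · rw [hθle k hk, hp]; linarith [hφle k]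
    · rw [hθgt k hk]; linarith [(hdk k hk).2.1]
  -- block 1 at every glued sample: the unique optimum is `A (κ₁ k)`
  have hU1 : ∀ k, ∀ S ∈ indepSets 0 n₁, S ≠ A (κ₁ k) →
      ∑ t ∈ S, W u₁ u₀ t (θs k) < ∑ t ∈ A (κ₁ k), W u₁ u₀ t (θs k) := by
    intro k
    by_cases hk : (k : ℕ) ≤ N₁
    · rw [hθle k hk]; exact huA (κ₁ k)
    · have hlast : κ₁ k = Fin.last N₁ := Fin.ext (by rw [hκ₁v, Fin.val_last]; omega)
      rw [hlast]
      refine hρA (θs k) (abs_le.mpr ⟨?_, ?_⟩)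
      · rw [hθgt k hk, hp]; linarith [(hdk k hk).2.2]
      · rw [hθgt k hk, hp]; linarith [(hdk k hk).2.1]
  -- block 2 at every glued sample, read through the Möbius map: the unique optimum is `B (κ₂ k)`
  have hU2 : ∀ k, ∀ S ∈ indepSets 0 n₂, S ≠ B (κ₂ k) →
      ∑ t ∈ S, W v₁ v₀ t (ψ 0 + c / (p - θs k)) < ∑ t ∈ B (κ₂ k), W v₁ v₀ t (ψ 0 + c / (p - θs k)) := by
    intro k
    by_cases hk : (k : ℕ) ≤ N₁
    · have hzero : κ₂ k = 0 := Fin.ext (by rw [hκ₂v, Fin.val_zero]; omega)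
      rw [hzero]
      have he : ρ ≤ p - θs k := by rw [hθle k hk, hp]; linarith [hφle k]
      have hepos : 0 < p - θs k := lt_of_lt_of_le hρ he
      refine hρB _ (abs_le.mpr ⟨?_, ?_⟩)
      · linarith [(div_pos hcpos hepos).le]
      · rw [add_sub_cancel_left, div_le_iff₀ hepos]; nlinarith
    · have hc0 : c ≠ 0 := hcpos.ne'
      have hg : ψ 0 + c / (p - θs k) = ψ (κ₂ k) := by
        rw [hθgt k hk, sub_sub_cancel, div_div_eq_mul_div, mul_div_cancel_left₀ _ hc0]; ring
      rw [hg]; exact huB (κ₂ k)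
  refine ⟨w₁, w₀, θs, Ms, ?_, fun k => ?_, fun k => ?_, fun e => ?_⟩
  · -- strictly increasing samples
    refine Fin.strictMono_iff_lt_succ.mpr fun e => ?_
    have hcs : ((Fin.castSucc e : Fin (N₁ + N₂ + 1)) : ℕ) = e := Fin.val_castSucc e
    have hsc : ((Fin.succ e : Fin (N₁ + N₂ + 1)) : ℕ) = e + 1 := Fin.val_succ e
    by_cases h1 : (e : ℕ) + 1 ≤ N₁
    · rw [hθle _ (by rw [hcs]; omega), hθle _ (by rw [hsc]; omega)]
      exact hφ (by rw [Fin.lt_def, hκ₁v, hκ₁v, hcs, hsc]; omega)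
    · by_cases h0 : (e : ℕ) ≤ N₁
      · rw [hθle _ (by rw [hcs]; omega), hθgt _ (by rw [hsc]; omega), hp]
        linarith [hφle (Fin.castSucc e), (hdk (Fin.succ e) (by rw [hsc]; omega)).2.2]
      · rw [hθgt _ (by rw [hcs]; omega), hθgt _ (by rw [hsc]; omega)]
        have ha : 0 < ψ (κ₂ (Fin.castSucc e)) - ψ 0 := lt_of_lt_of_le hmpos (hdk _ (by rw [hcs]; omega)).1
        have hlt : ψ (κ₂ (Fin.castSucc e)) - ψ 0 < ψ (κ₂ (Fin.succ e)) - ψ 0 :=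
          sub_lt_sub_right (hψ (by rw [Fin.lt_def, hκ₂v, hκ₂v, hcs, hsc]; omega)) _
        linarith [div_lt_div_of_pos_left hcpos ha hlt]
  · -- independent
    simp only [hMs]
    exact union_mem_indepSets (hA _) (map_add_mem_indepSets (n₁ + 1) (hB _)) (by omega) (by omega)
  · -- unique optimum, block by block around the separator
    have hθ := hθp k
    simp only [hMs]
    refine glue_unique w₁ w₀ (hA (κ₁ k)) (map_add_mem_indepSets (n₁ + 1) (hB (κ₂ k))) (fun S hS => ?_)
      (fun S' hS' => ?_) (by rw [hWsep]; norm_num)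
    · rw [hsum1 S hS, hsum1 _ (hA _)]
      refine ⟨?_, hU1 k S hS⟩
      rcases eq_or_ne S (A (κ₁ k)) with h | h
      · rw [h]
      · exact (hU1 k S hS h).le
    · obtain ⟨S, hS, rfl⟩ := exists_eq_map_add hS'
      rw [hsum2 S hS _ hθ, hsum2 _ (hB _) _ hθ]
      have hpos : 0 < p - θs k := sub_pos.mpr hθ
      refine ⟨?_, fun hne => ?_⟩
      · rcases eq_or_ne S (B (κ₂ k)) with h | h
        · rw [h]
        · exact (mul_lt_mul_of_pos_left (hU2 k S hS h) hpos).le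
      · exact mul_lt_mul_of_pos_left (hU2 k S hS fun h => hne (by rw [h])) hpos
  · -- consecutive optima differ
    intro heq
    simp only [hMs] at heq
    have hlow : ∀ k, ∀ t ∈ A (κ₁ k), t ≤ n₁ := fun k t ht => by
      have := mem_Ioc.mp ((mem_indepSets.mp (hA (κ₁ k))).1 ht); omega
    have hhigh : ∀ k, ∀ t ∈ (B (κ₂ k)).map (addLeftEmbedding (n₁ + 1)), n₁ < t := fun k t ht => by
      have := mem_Ioc.mp ((mem_indepSets.mp (map_add_mem_indepSets (n₁ + 1) (hB (κ₂ k)))).1 ht); omega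
    obtain ⟨hAeq, hBeq⟩ := eq_and_eq_of_union_eq (hlow _) (hlow _) (hhigh _) (hhigh _) heq
    by_cases h1 : (e : ℕ) < N₁
    · -- inside chain 1
      have hc' : κ₁ (Fin.castSucc e) = Fin.castSucc ⟨e, h1⟩ :=
        Fin.ext (by simp only [hκ₁v, Fin.val_castSucc]; omega)
      have hs' : κ₁ (Fin.succ e) = Fin.succ ⟨e, h1⟩ :=
        Fin.ext (by simp only [hκ₁v, Fin.val_succ]; omega)
      exact hAs ⟨e, h1⟩ (by rw [← hc', ← hs', hAeq])
    · -- inside chain 2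
      have h2 : (e : ℕ) - N₁ < N₂ := by have := e.isLt; omega
      have hc' : κ₂ (Fin.castSucc e) = Fin.castSucc ⟨(e : ℕ) - N₁, h2⟩ :=
        Fin.ext (by simp only [hκ₂v, Fin.val_castSucc])
      have hs' : κ₂ (Fin.succ e) = Fin.succ ⟨(e : ℕ) - N₁, h2⟩ :=
        Fin.ext (by simp only [hκ₂v, Fin.val_succ]; omega)
      exact hBs ⟨(e : ℕ) - N₁, h2⟩ (by rw [← hc', ← hs']; exact Finset.map_injective _ hBeq)

/-- **SUPERADDITIVITY OF CHAINS (existential form of `chain_glue`).** [folklore] -/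
theorem exists_chain_add {n₁ N₁ n₂ N₂ : ℕ}
    (h₁ : ∃ (w₁ w₀ : ℕ → ℝ) (θs : Fin (N₁ + 1) → ℝ) (Ms : Fin (N₁ + 1) → Finset ℕ),
      StrictMono θs ∧ (∀ k, Ms k ∈ indepSets 0 n₁) ∧
      (∀ k, ∀ S ∈ indepSets 0 n₁, S ≠ Ms k → ∑ t ∈ S, W w₁ w₀ t (θs k) < ∑ t ∈ Ms k, W w₁ w₀ t (θs k)) ∧
      (∀ e : Fin N₁, Ms e.castSucc ≠ Ms e.succ))
    (h₂ : ∃ (w₁ w₀ : ℕ → ℝ) (θs : Fin (N₂ + 1) → ℝ) (Ms : Fin (N₂ + 1) → Finset ℕ),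
      StrictMono θs ∧ (∀ k, Ms k ∈ indepSets 0 n₂) ∧
      (∀ k, ∀ S ∈ indepSets 0 n₂, S ≠ Ms k → ∑ t ∈ S, W w₁ w₀ t (θs k) < ∑ t ∈ Ms k, W w₁ w₀ t (θs k)) ∧
      (∀ e : Fin N₂, Ms e.castSucc ≠ Ms e.succ)) :
    ∃ (w₁ w₀ : ℕ → ℝ) (θs : Fin (N₁ + N₂ + 1) → ℝ) (Ms : Fin (N₁ + N₂ + 1) → Finset ℕ),
      StrictMono θs ∧ (∀ k, Ms k ∈ indepSets 0 (n₁ + 1 + n₂)) ∧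
      (∀ k, ∀ S ∈ indepSets 0 (n₁ + 1 + n₂), S ≠ Ms k →
        ∑ t ∈ S, W w₁ w₀ t (θs k) < ∑ t ∈ Ms k, W w₁ w₀ t (θs k)) ∧
      (∀ e : Fin (N₁ + N₂), Ms e.castSucc ≠ Ms e.succ) := by
  obtain ⟨u₁, u₀, φ, A, hφ, hA, huA, hAs⟩ := h₁
  obtain ⟨v₁, v₀, ψ, B, hψ, hB, huB, hBs⟩ := h₂
  exact chain_glue u₁ u₀ φ A hφ hA huA hAs v₁ v₀ ψ B hψ hB huB hBs

end

end StaticPathFold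

end Summit.ValiantsHypothesis.ValiantsHypothesis.Theorems.KPlusLogSqLaw
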